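import Literature.MathematicalPhysics.QuantumFieldTheory.Balaban1983to89.Node00.CarriersB13DecoratedTower

/-!
# `Balaban1983to89.B13CondTowerLocationNumerals` — T. Bałaban, *Renormalization group approach to lattice gauge field theories. II.
# Cluster expansions*, Commun. Math. Phys. **116** (1988) 1–22 [Balaban1988RG2Cluster], (2.3) p. 12 (the bond sets of a term), p. 13 (the
# σ-region `X` of a term and its distance to the bonds, «M large»), (2.5)–(2.6) pp. 12–13 (interior ∕ exterior bonds); T. Bałaban,
# *Propagators for lattice gauge theories in a background field*, Commun. Math. Phys. **99** (1985) 389–434 [Balaban1985BackgroundPropagators],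
# Thm 3.10 (3.107)–(3.108) p. 416 (bond multiplicities in the random-walk expansion): THE GEOMETRIC BINDERS OF THE N10 JUNCTIONS — fibre
# counts of the bond locations (`hfibN`, `hKmult`, `hfibF`) and far-ness of the σ-region (`hKfar`) — READ OFF THE RECORD'S FINITE LOCATION DATA
# `locN ∕ X ∕ locF` of the conditioned (`Node00.ResidB13C`, S5) and decorated (`Node00.ResidB13D`, S6) kernel tower of record, as THREE LOCATED NUMERALS
# (`locNFibreMax`, `sigmaDistFloor`, `locFFibreMax`): each binder is the located inequality «rung numeral vs. record numeral».

statement-level finite bookkeeping ([folklore]: the largest fibre of a map on a finite type, a `Finset.sup`; the least element of a set of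
non-negative reals, a conditionally complete `sInf`) over the landed tower modules `Node00/CarriersB13CondTower` (pub-ymgap dag-n10-w3, S5) and
`Node00/CarriersB13DecoratedTower` (dag-n10-w3, S6) and the torus distance `B9Thm37GlueTorus.tdist1`, with citation tags; kernel-checked; transparent
numeral `def`s + theorems (no `structure`, no instance, no notation); nothing of `Node00/CarriersB13*` is modified (successor-module discipline);
nothing here is a claim about the Yang–Mills mass gap; nothing of Bałaban's operators or geometry is constructed or asserted; no node is discharged;
count-neutral.

WHY THIS FILE (cell `pub-ymgap`, HUMAN RULING D-0062 ∕ D-0149, Track A node N10 = [B13]; width seat `pub-ymgap-dag-n10-w4` g2, CLAIM-3 ∕ INTENT-3; the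
n10-c lane's census `N10-RESIDUAL-CENSUS-v15∕v16.md`, class «★ NODE A about the record's own fields», sub-block «`hKfar hKmult hKdim`» and the fibre
binders).  The junction editions at def-B13's kernel tower — `Thm/BalabanUVNodesN10B13KernelTowerWalksEntrywiseCond` (62), `…EntrywiseNumerals` (64),
`…EntrywiseDecorated` (65), ★ `…EntrywiseNumeralsDecorated` (67) — DISPLAY, next to NODE A's letters, four binders that speak ONLY of the record's
location data and two rung ∕ walk numerals:
`hfibN : ∀ Z t x, #{j | (𝒦 Z t).locN j = x} ≤ m` · `hKmult : ∀ Z, ∀ t ∈ terms …, ∀ x, #{k | (𝒦 Z t).locN k = x} ≤ rf.nB` ·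
`hKfar : ∀ Z, ∀ t ∈ terms …, ∀ k, ∀ z ∈ (𝒦 Z t).X, rf.Rσ ≤ d₁((𝒦 Z t).locN k, z)` · `hfibF : ∀ Z t y, #{k | lamD.locF Z t k = y} ≤ mF`.
The index `(Z, t)` of a layer is FINITE (`TDom × B13TermIdx`) and so are the bond types, so these are located inequalities against THREE numbers
of the record: the largest location fibre `locNFibreMax` (resp. `locFFibreMax`) and the least bond-to-σ-region distance `sigmaDistFloor`.  With
dag-n10-w1's (2.24)–(2.26) numerals, dag-n10-w2's located inverse radius, dag-n10-w3's rate budget and this seat's accretive floor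
(`B13CondTowerAccretiveFloor`), the rung-side display of the junction becomes a list of inequalities among named numerals; in particular print's
«M large» tension reads `Rσmin(numerals) ≤ rf.Rσ ≤ sigmaDistFloor(record)` (`hPσ hAσ hRσlarge` vs `hKfar`).

WHAT THIS FILE PROVES.
* §1 [folklore]: `fibreMax f` (the largest fibre cardinality of a map on a finite type, `Finset.sup` of the fibres through each point),
  `card_fibre_le_fibreMax` (EVERY fibre, also an empty one, is bounded by it), `fibreMax_le_card`.
* §2 AT THE CONDITIONED TOWER `lamC : ResidB13C θ` (S5): `locNFibreMax lamC` (+ `card_locN_fibre_le`), ★ `hfibN_of_locNFibreMax_le` (62∕64's `hfibN` text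
  at `lamC.toK` from `locNFibreMax lamC ≤ m`), ★ `hKmult_of_locNFibreMax_le` (`hKmult` text from `locNFibreMax lamC ≤ rf.nB`); `sigmaDistFloor lamC := sInf`
  of the bond-to-σ-region distances (+ `sigmaDistFloor_nonneg`, `sigmaDistFloor_le`, `le_sigmaDistFloor` — exactness for a nonempty family),
  ★ `hKfar_of_le_sigmaDistFloor` (`hKfar` text at `lamC.toK` from `rf.Rσ ≤ sigmaDistFloor lamC`).
* §3 AT THE DECORATED TOWER `lamD : ResidB13D θ` (S6): `locFFibreMax lamD` (+ `card_locF_fibre_le`), ★ `hfibF_of_locFFibreMax_le` (67's `hfibF` text from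
  `locFFibreMax lamD ≤ mF`), and 67's `hfibN ∕ hKmult ∕ hKfar` texts at `lamD.toC`: `hfibN_decTower_of_le`, `hKmult_decTower_of_le`, `hKfar_decTower_of_le`.
* §4 (v1.1, append-only) THE DECORATION's CARDINAL EXCESS: `decorExcess lamD M₁ : ℕ` (largest `⌈#J(i,j) − d₁(locF i, locF j)∕M₁⌉₊`), `ceil_le_decorExcess`,
  `card_J_le_of_decorExcess_le`, `decorExcess_le_of_card_le` (exactness), ★ `hGJ_of_laws_of_decorExcess_le` (67's `hGJ` text from the two LAWS `symm`∕`through`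
  of the data `J, locF, X` + `0 < M₁` + the located inequality `decorExcess lamD M₁ ≤ c₀`).
* §5 (v1.1, append-only) THE AVERAGING OPERATOR's SIZE AND RANGE: `cmAbsMax lamD : ℝ≥0` (`abs_cm_le_cmAbsMax`, ★ `hCle_of_cmAbsMax_le_one` — 67's `hCle` from the
  located check `cmAbsMax lamD ≤ 1`), `cmRange lamD : ℝ≥0` (`tdist1_le_cmRange`, ★ `hCsupp_of_cmRange_le` — 67's `hCsupp` from `cmRange lamD ≤ rC`).
* §6 (v1.2, append-only) THE CONSUMER SIDE — INTRODUCTION RULES (each maximum ∕ range numeral is SHARP, so the located inequalities of the all-located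
  junction edition 67RDL are EQUIVALENT to the binders they replace): `fibreMax_le_of_forall_card_le`, `locNFibreMax_le_of_forall` ∕ ★ `locNFibreMax_le_iff` ∕
  `locNFibreMax_le_of_hfibN` (62∕64's text) ∕ `locNFibreMax_decTower_le_of_hfibN` (67's text), `locFFibreMax_le_of_forall` ∕ ★ `locFFibreMax_le_iff`,
  `cmAbsMax_le_of_forall` ∕ ★ `cmAbsMax_le_one_iff`, `cmRange_le_of_forall` ∕ ★ `cmRange_le_iff` (`sigmaDistFloor` and `decorExcess` already have theirs:
  `le_sigmaDistFloor` §2, `decorExcess_le_of_card_le` §4).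
HONEST FRAMING: located bookkeeping of FINITE data; the numerals are the record's DATA (`locN`, `X`, `locF`) — print's k-uniform multiplicities and the
«M large» geometry of the σ-regions ([II] p. 13) are NEITHER proved NOR claimed, and WHICH locations the record of a member HAS is def-T's term tower
(census v16 item 2); `hKX` (non-emptiness of `X`), `hKdim`, the letters `hEL hGJ hCle hCsupp` are untouched; N10 NOT discharged; K1⁷ NOT closed; counts
unmoved (typed 28∕28 · discharged 5∕27); no `sorry`, no new named fact; standard axioms; one finite 𝕋⁴ programme at fixed ε, Bałaban AS PRINTED; the YM
mass gap (Clay) is NOT proved by any of this — R4 closes the conditional finite-𝕋⁴ rung `BalabanLadder.UV` only; nothing continuum ∕ ℝ⁴ ∕ OS.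

References: T. Bałaban, CMP 116 (1988) 1–22 [Balaban1988RG2Cluster] (2.3) p.12, p.13, (2.5)–(2.6) pp.12–13, (2.14) p.15; CMP 99 (1985) 389–434
[Balaban1985BackgroundPropagators] Thm 3.10 (3.107)–(3.108) p.416, Thm 3.12 p.423.
-/

noncomputable section

namespace Literature.MathematicalPhysics.QuantumFieldTheory.Balaban1983to89.B13CondTowerLocationNumerals

open Finset
open scoped Matrix
open Literature.MathematicalPhysics.QuantumFieldTheory.Balaban1983to89
open Literature.MathematicalPhysics.QuantumFieldTheory.Balaban1983to89.Node00 (Stage3Params ResidB13C ResidB13D B13TermIdx)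
open Literature.MathematicalPhysics.QuantumFieldTheory.Balaban1983to89.TreeLengthTorus (TDom TPt)
open Literature.MathematicalPhysics.QuantumFieldTheory.Balaban1983to89.B13Lemma3TorusTerms (terms)
open Literature.MathematicalPhysics.QuantumFieldTheory.Balaban1983to89.B5TorusCover (UT)
open Literature.MathematicalPhysics.QuantumFieldTheory.Balaban1983to89.B9Thm37GlueTorus (tdist1 tdist1_nonneg)
open Literature.MathematicalPhysics.QuantumFieldTheory.Balaban1983to89.NodeOLettersOfWalksPerturbative (RefPackage)

/-! ## §1. Folklore: the largest fibre of a map on a finite type -/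

section Fibre

variable {α β : Type*} [Fintype α] [DecidableEq β]

/-- **THE LARGEST FIBRE CARDINALITY** of a map `f` on a finite type: the `sup` over the points `a` of the cardinality of the fibre through `a`
(a transparent numeral; `0` on an empty domain; the codomain need not be finite). [folklore]
[cite: Balaban1985BackgroundPropagators, Thm 3.10 (3.107) p.416] -/
def fibreMax (f : α → β) : ℕ := Finset.univ.sup fun a => (Finset.univ.filter fun k => f k = f a).card

/-- EVERY fibre is bounded by `fibreMax` (an empty fibre trivially; a non-empty one is the fibre through any of its points).
[folklore] [cite: Balaban1985BackgroundPropagators, Thm 3.10 (3.107) p.416] -/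
theorem card_fibre_le_fibreMax (f : α → β) (y : β) : (Finset.univ.filter fun k => f k = y).card ≤ fibreMax f := by
  by_cases h : (Finset.univ.filter fun k => f k = y).Nonempty
  · obtain ⟨a, ha⟩ := h
    have hfa : f a = y := (Finset.mem_filter.1 ha).2
    calc (Finset.univ.filter fun k => f k = y).card = (Finset.univ.filter fun k => f k = f a).card := by rw [hfa]
      _ ≤ fibreMax f := Finset.le_sup (f := fun a => (Finset.univ.filter fun k => f k = f a).card) (Finset.mem_univ a)
  · rw [Finset.not_nonempty_iff_eq_empty.1 h, Finset.card_empty]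
    exact Nat.zero_le _

/-- The largest fibre is at most the whole domain. [folklore] [cite: Balaban1985BackgroundPropagators, Thm 3.10 (3.107) p.416] -/
theorem fibreMax_le_card (f : α → β) : fibreMax f ≤ Fintype.card α :=
  Finset.sup_le fun _ _ => (Finset.card_filter_le _ _).trans (Finset.card_univ.le)

end Fibre

/-! ## §2. At the conditioned kernel tower of record (S5): `locNFibreMax`, `sigmaDistFloor` -/

section CondTower

variable {θ : Stage3Params} (lamC : ResidB13C θ)

/-- **THE LARGEST LOCATION FIBRE OF THE LAYER's BONDS** `locNFibreMax lamC`: over the finite index `(Z, t)` and the bonds `Λ Z t ⊕ C₀ Z t`, the largest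
number of bonds of one term sitting at one site of [13]'s torus — the located numeral behind the junctions' `hfibN` (`≤ m`) and `hKmult` (`≤ rf.nB`).
A number of the record's DATA `locN`. [cite: Balaban1985BackgroundPropagators, Thm 3.10 (3.107) p.416; Balaban1988RG2Cluster, (2.5)–(2.6) pp.12–13] -/
def locNFibreMax : ℕ :=
  (Finset.univ : Finset (TDom 4 (lamC.n + 1) × B13TermIdx θ lamC.n lamC.m₃)).sup fun zt => fibreMax (lamC.locN zt.1 zt.2)

/-- Every location fibre of every term is bounded by `locNFibreMax`. [cite: Balaban1985BackgroundPropagators, Thm 3.10 (3.107) p.416] -/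
theorem card_locN_fibre_le (Z : TDom 4 (lamC.n + 1)) (t : B13TermIdx θ lamC.n lamC.m₃) (x : UT lamC.Nf) :
    (Finset.univ.filter fun k => lamC.locN Z t k = x).card ≤ locNFibreMax lamC :=
  (card_fibre_le_fibreMax (lamC.locN Z t) x).trans
    (Finset.le_sup (f := fun zt : TDom 4 (lamC.n + 1) × B13TermIdx θ lamC.n lamC.m₃ => fibreMax (lamC.locN zt.1 zt.2))
      (Finset.mem_univ (Z, t)))

/-- ★ **THE JUNCTIONS' `hfibN` (62 ∕ 64, verbatim at `lamC.toK`) FROM THE LOCATED INEQUALITY `locNFibreMax lamC ≤ m`.**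
[cite: Balaban1985BackgroundPropagators, Thm 3.10 (3.107) p.416; Balaban1988RG2Cluster, (2.5)–(2.6) pp.12–13] -/
theorem hfibN_of_locNFibreMax_le {m : ℕ} (hm : locNFibreMax lamC ≤ m) :
    ∀ Z t (x : UT lamC.toK.Nf), (Finset.univ.filter fun j => (lamC.toK.𝒦 Z t).locN j = x).card ≤ m :=
  fun Z t x => (card_locN_fibre_le lamC Z t x).trans hm

/-- ★ **THE JUNCTIONS' `hKmult` (62 ∕ 64, verbatim at `lamC.toK`) FROM THE LOCATED INEQUALITY `locNFibreMax lamC ≤ rf.nB`** — the walk package's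
multiplicity numeral against the record's. [cite: Balaban1985BackgroundPropagators, Thm 3.10 (3.107)–(3.108) p.416, Thm 3.12 p.423] -/
theorem hKmult_of_locNFibreMax_le (rf : RefPackage) (hnB : locNFibreMax lamC ≤ rf.nB) :
    ∀ Z, ∀ t ∈ terms (θ.ℓ₆ + 1) (lamC.toK.layer.m₃ + 1) Z, ∀ x : UT lamC.toK.Nf,
      (Finset.univ.filter fun k => (lamC.toK.𝒦 Z t).locN k = x).card ≤ rf.nB :=
  fun Z t _ x => (card_locN_fibre_le lamC Z t x).trans hnB

/-- **THE LEAST BOND-TO-σ-REGION DISTANCE OF THE LAYER** `sigmaDistFloor lamC`: the infimum (a minimum when some term has a bond and a non-empty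
σ-region; `0` for the empty family) of `d₁(locN Z t k, z)` over all terms `(Z, t)`, bonds `k` and cubes `z ∈ X Z t` — the located numeral behind the
junctions' far-ness `hKfar` (`rf.Rσ ≤ …`); print's «X far from the bonds of the term, M large» ([II] p. 13) at the record's DATA `locN ∕ X`.
[cite: Balaban1988RG2Cluster, p.13, (2.14) p.15; Balaban1985BackgroundPropagators, Thm 3.12 p.423] -/
def sigmaDistFloor : ℝ :=
  sInf {r : ℝ | ∃ (Z : TDom 4 (lamC.n + 1)) (t : B13TermIdx θ lamC.n lamC.m₃) (k : lamC.Λ Z t ⊕ lamC.C₀ Z t) (z : UT lamC.Nf),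
    z ∈ lamC.X Z t ∧ r = tdist1 lamC.Nf (lamC.locN Z t k) z}

/-- The distance set is bounded below by `0` (plumbing). [folklore] -/
private theorem bddBelow_distSet :
    BddBelow {r : ℝ | ∃ (Z : TDom 4 (lamC.n + 1)) (t : B13TermIdx θ lamC.n lamC.m₃) (k : lamC.Λ Z t ⊕ lamC.C₀ Z t) (z : UT lamC.Nf),
      z ∈ lamC.X Z t ∧ r = tdist1 lamC.Nf (lamC.locN Z t k) z} :=
  ⟨0, fun _ ⟨_, _, _, _, _, hr⟩ => hr ▸ tdist1_nonneg _ _⟩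

/-- The σ-distance floor is non-negative. [cite: Balaban1988RG2Cluster, p.13] -/
theorem sigmaDistFloor_nonneg : 0 ≤ sigmaDistFloor lamC :=
  Real.sInf_nonneg fun _ ⟨_, _, _, _, _, hr⟩ => hr ▸ tdist1_nonneg _ _

/-- The σ-distance floor is BELOW every bond-to-σ-region distance of every term. [cite: Balaban1988RG2Cluster, p.13, (2.14) p.15] -/
theorem sigmaDistFloor_le (Z : TDom 4 (lamC.n + 1)) (t : B13TermIdx θ lamC.n lamC.m₃) (k : lamC.Λ Z t ⊕ lamC.C₀ Z t)
    {z : UT lamC.Nf} (hz : z ∈ lamC.X Z t) : sigmaDistFloor lamC ≤ tdist1 lamC.Nf (lamC.locN Z t k) z :=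
  csInf_le (bddBelow_distSet lamC) ⟨Z, t, k, z, hz, rfl⟩

/-- EXACTNESS: for a non-empty family (some term has a bond and a non-empty σ-region) the floor is the LARGEST common lower bound — any `R` below all
the distances is below the floor (so `rf.Rσ ≤ sigmaDistFloor lamC` IS the junctions' `hKfar`, not merely sufficient). [cite: Balaban1988RG2Cluster, p.13] -/
theorem le_sigmaDistFloor {R : ℝ}
    (hne : ∃ (Z : TDom 4 (lamC.n + 1)) (t : B13TermIdx θ lamC.n lamC.m₃) (_ : lamC.Λ Z t ⊕ lamC.C₀ Z t), (lamC.X Z t).Nonempty)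
    (hR : ∀ (Z : TDom 4 (lamC.n + 1)) (t : B13TermIdx θ lamC.n lamC.m₃) (k : lamC.Λ Z t ⊕ lamC.C₀ Z t), ∀ z ∈ lamC.X Z t,
      R ≤ tdist1 lamC.Nf (lamC.locN Z t k) z) :
    R ≤ sigmaDistFloor lamC := by
  obtain ⟨Z, t, k, z, hz⟩ := hne
  exact le_csInf ⟨_, Z, t, k, z, hz, rfl⟩ fun _ ⟨Z', t', k', z', hz', hr⟩ => hr ▸ hR Z' t' k' z' hz'

/-- ★ **THE JUNCTIONS' FAR-NESS `hKfar` (62 ∕ 64, verbatim at `lamC.toK`) FROM THE LOCATED INEQUALITY `rf.Rσ ≤ sigmaDistFloor lamC`** — the rung's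
exchange distance against the record's least bond-to-σ-region distance (print's «M large», [II] p. 13).
[cite: Balaban1988RG2Cluster, p.13, (2.14) p.15; Balaban1985BackgroundPropagators, Thm 3.12 p.423] -/
theorem hKfar_of_le_sigmaDistFloor (rf : RefPackage) (hRσ : rf.Rσ ≤ sigmaDistFloor lamC) :
    ∀ Z, ∀ t ∈ terms (θ.ℓ₆ + 1) (lamC.toK.layer.m₃ + 1) Z, ∀ k, ∀ z ∈ (lamC.toK.𝒦 Z t).X,
      rf.Rσ ≤ tdist1 lamC.toK.Nf ((lamC.toK.𝒦 Z t).locN k) z :=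
  fun Z t _ k _ hz => hRσ.trans (sigmaDistFloor_le lamC Z t k hz)

end CondTower

/-! ## §3. At the decorated kernel tower of record (S6): `locFFibreMax` and module 67's texts -/

section DecoratedTower

variable {θ : Stage3Params} (lamD : ResidB13D θ)

/-- **THE LARGEST FINE-BOND LOCATION FIBRE OF THE LAYER** `locFFibreMax lamD`: over the finite index `(Z, t)` and the fine bonds `P Z t`, the largest number
of fine bonds of one term located at one site — the located numeral behind 65 ∕ 67's `hfibF` (`≤ mF`). A number of the record's DATA `locF`.
[cite: Balaban1985BackgroundPropagators, Thm 3.10 (3.107)–(3.108) p.416] -/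
def locFFibreMax : ℕ :=
  (Finset.univ : Finset (TDom 4 (lamD.n + 1) × B13TermIdx θ lamD.n lamD.m₃)).sup fun zt => fibreMax (lamD.locF zt.1 zt.2)

/-- Every fine-bond location fibre of every term is bounded by `locFFibreMax`. [cite: Balaban1985BackgroundPropagators, Thm 3.10 (3.107) p.416] -/
theorem card_locF_fibre_le (Z : TDom 4 (lamD.n + 1)) (t : B13TermIdx θ lamD.n lamD.m₃) (y : UT lamD.Nf) :
    (Finset.univ.filter fun k => lamD.locF Z t k = y).card ≤ locFFibreMax lamD :=
  (card_fibre_le_fibreMax (lamD.locF Z t) y).trans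
    (Finset.le_sup (f := fun zt : TDom 4 (lamD.n + 1) × B13TermIdx θ lamD.n lamD.m₃ => fibreMax (lamD.locF zt.1 zt.2))
      (Finset.mem_univ (Z, t)))

/-- ★ **MODULE 67's `hfibF` (verbatim) FROM THE LOCATED INEQUALITY `locFFibreMax lamD ≤ mF`.** [cite: Balaban1985BackgroundPropagators, Thm 3.10 (3.107)–(3.108) p.416] -/
theorem hfibF_of_locFFibreMax_le {mF : ℕ} (hmF : locFFibreMax lamD ≤ mF) :
    ∀ Z t (y : UT lamD.toC.toK.Nf), (Finset.univ.filter fun k => lamD.locF Z t k = y).card ≤ mF :=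
  fun Z t y => (card_locF_fibre_le lamD Z t y).trans hmF

/-- MODULE 67's `hfibN` (verbatim at `lamD.toC.toK`) from `locNFibreMax lamD.toC ≤ m`. [cite: Balaban1985BackgroundPropagators, Thm 3.10 (3.107) p.416] -/
theorem hfibN_decTower_of_le {m : ℕ} (hm : locNFibreMax lamD.toC ≤ m) :
    ∀ Z t (x : UT lamD.toC.toK.Nf), (Finset.univ.filter fun j => (lamD.toC.toK.𝒦 Z t).locN j = x).card ≤ m :=
  hfibN_of_locNFibreMax_le lamD.toC hm

/-- MODULE 67's `hKmult` (verbatim at `lamD.toC.toK`) from `locNFibreMax lamD.toC ≤ rf.nB`. [cite: Balaban1985BackgroundPropagators, Thm 3.10 (3.107)–(3.108) p.416, Thm 3.12 p.423] -/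
theorem hKmult_decTower_of_le (rf : RefPackage) (hnB : locNFibreMax lamD.toC ≤ rf.nB) :
    ∀ Z, ∀ t ∈ terms (θ.ℓ₆ + 1) (lamD.toC.toK.layer.m₃ + 1) Z, ∀ x : UT lamD.toC.toK.Nf,
      (Finset.univ.filter fun k => (lamD.toC.toK.𝒦 Z t).locN k = x).card ≤ rf.nB :=
  hKmult_of_locNFibreMax_le lamD.toC rf hnB

/-- ★ MODULE 67's far-ness `hKfar` (verbatim at `lamD.toC.toK`) from `rf.Rσ ≤ sigmaDistFloor lamD.toC`. [cite: Balaban1988RG2Cluster, p.13, (2.14) p.15; Balaban1985BackgroundPropagators, Thm 3.12 p.423] -/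
theorem hKfar_decTower_of_le (rf : RefPackage) (hRσ : rf.Rσ ≤ sigmaDistFloor lamD.toC) :
    ∀ Z, ∀ t ∈ terms (θ.ℓ₆ + 1) (lamD.toC.toK.layer.m₃ + 1) Z, ∀ k, ∀ z ∈ (lamD.toC.toK.𝒦 Z t).X,
      rf.Rσ ≤ tdist1 lamD.toC.toK.Nf ((lamD.toC.toK.𝒦 Z t).locN k) z :=
  hKfar_of_le_sigmaDistFloor lamD.toC rf hRσ

end DecoratedTower

/-! ## §4. (v1.1, append-only) The cube decoration's cardinal excess: the numeral half of `hGJ` -/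

section Decoration

open Literature.MathematicalPhysics.QuantumFieldTheory.Balaban1983to89.B13EntrywiseWalks (GeodesicDecoration)

variable {θ : Stage3Params} (lamD : ResidB13D θ)

/-- Ceiling plumbing: `⌈a − b⌉₊ ≤ c ⟹ a ≤ c + b`. [folklore] -/
private theorem le_add_of_ceil_sub_le {a b : ℝ} {c : ℕ} (h : ⌈a - b⌉₊ ≤ c) : a ≤ c + b := by
  have h1 : a - b ≤ (⌈a - b⌉₊ : ℝ) := Nat.le_ceil _
  have h2 : (⌈a - b⌉₊ : ℝ) ≤ c := by exact_mod_cast h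
  linarith

/-- Ceiling plumbing: `a ≤ c + b ⟹ ⌈a − b⌉₊ ≤ c` (`c ∈ ℕ`). [folklore] -/
private theorem ceil_sub_le_of_le_add {a b : ℝ} {c : ℕ} (h : a ≤ c + b) : ⌈a - b⌉₊ ≤ c :=
  Nat.ceil_le.2 (by linarith)

/-- **THE DECORATION's CARDINAL EXCESS AT SLOPE `1∕M₁`** `decorExcess lamD M₁`: over the finite index `(Z, t)` and the ordered pairs of fine bonds `(i, j)`,
the largest `⌈#J(i,j) − d₁(locF i, locF j)∕M₁⌉₊` — the located numeral behind the CARDINAL clause `card_le` of the junctions' geodesic-decoration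
letter `hGJ` (`#J(i,j) ≤ c₀ + d₁(i,j)∕M₁`, [II] p. 3 after (1.7) and (1.11) p. 5: a pair is coupled through the cubes on a geodesic between its bonds,
so the count grows at most linearly in the distance); the other two clauses of `GeodesicDecoration` (`symm`, `through`) are LAWS of the data `J, locF, X`
and stay displayed. A number of the record's DATA. [cite: Balaban1988RG2Cluster, p.3, (1.11) p.5, p.13] -/
def decorExcess (M₁ : ℝ) : ℕ :=
  (Finset.univ : Finset (TDom 4 (lamD.n + 1) × B13TermIdx θ lamD.n lamD.m₃)).sup fun zt =>
    (Finset.univ : Finset (lamD.P zt.1 zt.2 × lamD.P zt.1 zt.2)).sup fun ij =>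
      ⌈((lamD.J zt.1 zt.2 ij).card : ℝ) - tdist1 lamD.Nf (lamD.locF zt.1 zt.2 ij.1) (lamD.locF zt.1 zt.2 ij.2) / M₁⌉₊

/-- Every pair's ceiling excess is bounded by `decorExcess`. [cite: Balaban1988RG2Cluster, p.3, (1.11) p.5] -/
theorem ceil_le_decorExcess (M₁ : ℝ) (Z : TDom 4 (lamD.n + 1)) (t : B13TermIdx θ lamD.n lamD.m₃) (i j : lamD.P Z t) :
    ⌈((lamD.J Z t (i, j)).card : ℝ) - tdist1 lamD.Nf (lamD.locF Z t i) (lamD.locF Z t j) / M₁⌉₊ ≤ decorExcess lamD M₁ :=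
  (Finset.le_sup (f := fun ij : lamD.P Z t × lamD.P Z t =>
      ⌈((lamD.J Z t ij).card : ℝ) - tdist1 lamD.Nf (lamD.locF Z t ij.1) (lamD.locF Z t ij.2) / M₁⌉₊) (Finset.mem_univ (i, j))).trans
    (Finset.le_sup (f := fun zt : TDom 4 (lamD.n + 1) × B13TermIdx θ lamD.n lamD.m₃ =>
      (Finset.univ : Finset (lamD.P zt.1 zt.2 × lamD.P zt.1 zt.2)).sup fun ij =>
        ⌈((lamD.J zt.1 zt.2 ij).card : ℝ) - tdist1 lamD.Nf (lamD.locF zt.1 zt.2 ij.1) (lamD.locF zt.1 zt.2 ij.2) / M₁⌉₊) (Finset.mem_univ (Z, t)))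

/-- The CARDINAL clause of `hGJ` at every `c₀ ≥ decorExcess lamD M₁`: `#J(i,j) ≤ c₀ + d₁(locF i, locF j)∕M₁` for every term and pair.
[cite: Balaban1988RG2Cluster, p.3, (1.11) p.5] -/
theorem card_J_le_of_decorExcess_le {M₁ : ℝ} {c₀ : ℕ} (hc₀ : decorExcess lamD M₁ ≤ c₀)
    (Z : TDom 4 (lamD.n + 1)) (t : B13TermIdx θ lamD.n lamD.m₃) (i j : lamD.P Z t) :
    ((lamD.J Z t (i, j)).card : ℝ) ≤ c₀ + tdist1 lamD.Nf (lamD.locF Z t i) (lamD.locF Z t j) / M₁ :=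
  le_add_of_ceil_sub_le ((ceil_le_decorExcess lamD M₁ Z t i j).trans hc₀)

/-- EXACTNESS: if the cardinal clause holds at `(c₀, M₁)` for every term and pair, then `decorExcess lamD M₁ ≤ c₀` (the numeral is the LEAST admissible
`c₀` at slope `1∕M₁`). [cite: Balaban1988RG2Cluster, p.3, (1.11) p.5] -/
theorem decorExcess_le_of_card_le {M₁ : ℝ} {c₀ : ℕ}
    (h : ∀ (Z : TDom 4 (lamD.n + 1)) (t : B13TermIdx θ lamD.n lamD.m₃) (i j : lamD.P Z t),
      ((lamD.J Z t (i, j)).card : ℝ) ≤ c₀ + tdist1 lamD.Nf (lamD.locF Z t i) (lamD.locF Z t j) / M₁) :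
    decorExcess lamD M₁ ≤ c₀ :=
  Finset.sup_le fun zt _ => Finset.sup_le fun ij _ => ceil_sub_le_of_le_add (h zt.1 zt.2 ij.1 ij.2)

/-- ★ **MODULE 67's GEODESIC-DECORATION LETTER `hGJ` (verbatim at `lamD.toC.toK`) FROM THE RECORD's TWO LAWS + ONE LOCATED INEQUALITY**: symmetry of
`J` and the geodesic-through-`X` property (laws of the data `J, locF, X`), a slope `0 < M₁`, and `decorExcess lamD M₁ ≤ c₀` give
`∀ Z, ∀ t ∈ terms …, GeodesicDecoration (lamD.J Z t) (lamD.locF Z t) (lamD.toC.toK.𝒦 Z t).X c₀ M₁` — so at the record `hGJ` = two laws + the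
located inequality on `(c₀, M₁)` (which also enter `hP2` and `hKP`). [cite: Balaban1988RG2Cluster, p.3, (1.11) p.5, p.13, (2.14) p.15] -/
theorem hGJ_of_laws_of_decorExcess_le {M₁ : ℝ} {c₀ : ℕ}
    (hsymm : ∀ (Z : TDom 4 (lamD.n + 1)) (t : B13TermIdx θ lamD.n lamD.m₃) (i j : lamD.P Z t), lamD.J Z t (j, i) = lamD.J Z t (i, j))
    (hthrough : ∀ (Z : TDom 4 (lamD.n + 1)) (t : B13TermIdx θ lamD.n lamD.m₃) (i j : lamD.P Z t), (lamD.J Z t (i, j)).Nonempty →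
      ∃ z ∈ lamD.X Z t, tdist1 lamD.Nf (lamD.locF Z t i) z + tdist1 lamD.Nf z (lamD.locF Z t j)
        ≤ tdist1 lamD.Nf (lamD.locF Z t i) (lamD.locF Z t j))
    (hM₁ : 0 < M₁) (hc₀ : decorExcess lamD M₁ ≤ c₀) :
    ∀ Z, ∀ t ∈ terms (θ.ℓ₆ + 1) (lamD.toC.toK.layer.m₃ + 1) Z,
      GeodesicDecoration (lamD.J Z t) (lamD.locF Z t) (lamD.toC.toK.𝒦 Z t).X c₀ M₁ :=
  fun Z t _ =>
    { symm := hsymm Z t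
      card_le := fun i j => card_J_le_of_decorExcess_le lamD hc₀ Z t i j
      through := hthrough Z t
      M₁_pos := hM₁ }

end Decoration

/-! ## §5. (v1.1, append-only) The real local averaging operator's size and range: `hCle`, `hCsupp` -/

section Averaging

variable {θ : Stage3Params} (lamD : ResidB13D θ)

open Classical in
/-- **THE LARGEST ENTRY OF THE AVERAGING OPERATOR** `cmAbsMax lamD : ℝ≥0`: `max |C Z t k i|` over the finite index — the located numeral behind 67's
`hCle : |lamD.Cm Z t k i| ≤ 1` (print's averaging weights are `≤ 1` by construction, [II] (2.5) p. 12; at the record this is the check `cmAbsMax lamD ≤ 1`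
on the DATA `Cm`). [cite: Balaban1988RG2Cluster, (2.5) p.12] -/
def cmAbsMax : NNReal :=
  (Finset.univ : Finset (TDom 4 (lamD.n + 1) × B13TermIdx θ lamD.n lamD.m₃)).sup fun zt =>
    (Finset.univ : Finset (lamD.P zt.1 zt.2 × (lamD.Λ zt.1 zt.2 ⊕ lamD.C₀ zt.1 zt.2))).sup fun ki =>
      (|lamD.Cm zt.1 zt.2 ki.1 ki.2|).toNNReal

/-- Every entry of `C` is bounded by `cmAbsMax`. [cite: Balaban1988RG2Cluster, (2.5) p.12] -/
theorem abs_cm_le_cmAbsMax (Z : TDom 4 (lamD.n + 1)) (t : B13TermIdx θ lamD.n lamD.m₃) (k : lamD.P Z t) (i : lamD.Λ Z t ⊕ lamD.C₀ Z t) :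
    |lamD.Cm Z t k i| ≤ (cmAbsMax lamD : ℝ) := by
  have h1 : (|lamD.Cm Z t k i|).toNNReal ≤ cmAbsMax lamD :=
    (Finset.le_sup (f := fun ki : lamD.P Z t × (lamD.Λ Z t ⊕ lamD.C₀ Z t) => (|lamD.Cm Z t ki.1 ki.2|).toNNReal)
        (Finset.mem_univ (k, i))).trans
      (Finset.le_sup (f := fun zt : TDom 4 (lamD.n + 1) × B13TermIdx θ lamD.n lamD.m₃ =>
        (Finset.univ : Finset (lamD.P zt.1 zt.2 × (lamD.Λ zt.1 zt.2 ⊕ lamD.C₀ zt.1 zt.2))).sup fun ki =>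
          (|lamD.Cm zt.1 zt.2 ki.1 ki.2|).toNNReal) (Finset.mem_univ (Z, t)))
  have h2 : |lamD.Cm Z t k i| ≤ ((|lamD.Cm Z t k i|).toNNReal : ℝ) := Real.le_coe_toNNReal _
  exact h2.trans (by exact_mod_cast h1)

/-- ★ **MODULE 67's `hCle` (verbatim) FROM THE LOCATED CHECK `cmAbsMax lamD ≤ 1`.** [cite: Balaban1988RG2Cluster, (2.5) p.12] -/
theorem hCle_of_cmAbsMax_le_one (h : (cmAbsMax lamD : ℝ) ≤ 1) : ∀ Z t k i, |lamD.Cm Z t k i| ≤ 1 :=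
  fun Z t k i => (abs_cm_le_cmAbsMax lamD Z t k i).trans h

open Classical in
/-- **THE RANGE OF THE AVERAGING OPERATOR** `cmRange lamD : ℝ≥0`: the largest distance `d₁(locF k, locN i)` over the NON-ZERO entries `C Z t k i ≠ 0` of the
finitely many terms — the located numeral behind 67's `hCsupp` (`C Z t k i ≠ 0 → d₁(locF k, locN i) ≤ rC`; print's averaging functions are supported in
one block, [II] (2.5) p. 12); `rC` also enters `hKP` (the rate file's `kbarFloor`). A number of the record's DATA `Cm, locF, locN`. [cite: Balaban1988RG2Cluster, (2.5) p.12, (2.14) p.15] -/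
def cmRange : NNReal :=
  (Finset.univ : Finset (TDom 4 (lamD.n + 1) × B13TermIdx θ lamD.n lamD.m₃)).sup fun zt =>
    (Finset.univ : Finset (lamD.P zt.1 zt.2 × (lamD.Λ zt.1 zt.2 ⊕ lamD.C₀ zt.1 zt.2))).sup fun ki =>
      if lamD.Cm zt.1 zt.2 ki.1 ki.2 ≠ 0 then (tdist1 lamD.Nf (lamD.locF zt.1 zt.2 ki.1) (lamD.locN zt.1 zt.2 ki.2)).toNNReal else 0

/-- Every non-zero entry of `C` joins locations within `cmRange`. [cite: Balaban1988RG2Cluster, (2.5) p.12] -/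
theorem tdist1_le_cmRange (Z : TDom 4 (lamD.n + 1)) (t : B13TermIdx θ lamD.n lamD.m₃) (k : lamD.P Z t) (i : lamD.Λ Z t ⊕ lamD.C₀ Z t)
    (hne : lamD.Cm Z t k i ≠ 0) : tdist1 lamD.Nf (lamD.locF Z t k) (lamD.locN Z t i) ≤ (cmRange lamD : ℝ) := by
  classical
  have h1 : (if lamD.Cm Z t k i ≠ 0 then (tdist1 lamD.Nf (lamD.locF Z t k) (lamD.locN Z t i)).toNNReal else 0) ≤ cmRange lamD :=
    (Finset.le_sup (f := fun ki : lamD.P Z t × (lamD.Λ Z t ⊕ lamD.C₀ Z t) =>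
        if lamD.Cm Z t ki.1 ki.2 ≠ 0 then (tdist1 lamD.Nf (lamD.locF Z t ki.1) (lamD.locN Z t ki.2)).toNNReal else 0)
        (Finset.mem_univ (k, i))).trans
      (Finset.le_sup (f := fun zt : TDom 4 (lamD.n + 1) × B13TermIdx θ lamD.n lamD.m₃ =>
        (Finset.univ : Finset (lamD.P zt.1 zt.2 × (lamD.Λ zt.1 zt.2 ⊕ lamD.C₀ zt.1 zt.2))).sup fun ki =>
          if lamD.Cm zt.1 zt.2 ki.1 ki.2 ≠ 0 then (tdist1 lamD.Nf (lamD.locF zt.1 zt.2 ki.1) (lamD.locN zt.1 zt.2 ki.2)).toNNReal else 0)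
        (Finset.mem_univ (Z, t)))
  rw [if_pos hne] at h1
  have h2 : tdist1 lamD.Nf (lamD.locF Z t k) (lamD.locN Z t i)
      ≤ ((tdist1 lamD.Nf (lamD.locF Z t k) (lamD.locN Z t i)).toNNReal : ℝ) := Real.le_coe_toNNReal _
  exact h2.trans (by exact_mod_cast h1)

/-- ★ **MODULE 67's `hCsupp` (verbatim at `lamD.toC.toK`) FROM THE LOCATED INEQUALITY `cmRange lamD ≤ rC`.** [cite: Balaban1988RG2Cluster, (2.5) p.12, (2.14) p.15] -/
theorem hCsupp_of_cmRange_le {rC : ℝ} (h : (cmRange lamD : ℝ) ≤ rC) :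
    ∀ Z t k i, lamD.Cm Z t k i ≠ 0 → tdist1 lamD.toC.toK.Nf (lamD.locF Z t k) ((lamD.toC.toK.𝒦 Z t).locN i) ≤ rC :=
  fun Z t k i hne => (tdist1_le_cmRange lamD Z t k i hne).trans h

end Averaging

/-! ## §6. (v1.2, append-only) The consumer side: the maxima and the range are SHARP — introduction rules, so each located inequality is
EQUIVALENT to the binder it replaces (`sigmaDistFloor`: `le_sigmaDistFloor` §2; `decorExcess`: `decorExcess_le_of_card_le` §4) -/

section IntroFibre

variable {α β : Type*} [Fintype α] [DecidableEq β]

/-- `fibreMax f ≤ m` from a bound on every fibre (the largest fibre is a fibre). [folklore]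
[cite: Balaban1985BackgroundPropagators, Thm 3.10 (3.107) p.416] -/
theorem fibreMax_le_of_forall_card_le (f : α → β) {m : ℕ} (h : ∀ y, (Finset.univ.filter fun k => f k = y).card ≤ m) : fibreMax f ≤ m :=
  Finset.sup_le fun a _ => h (f a)

end IntroFibre

section IntroCond

variable {θ : Stage3Params} (lamC : ResidB13C θ)

/-- **INTRODUCTION RULE for `locNFibreMax`**: a bound on every location fibre of every index `(Z, t)` bounds the numeral. [cite: Balaban1985BackgroundPropagators, Thm 3.10 (3.107) p.416] -/
theorem locNFibreMax_le_of_forall {m : ℕ}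
    (h : ∀ (Z : TDom 4 (lamC.n + 1)) (t : B13TermIdx θ lamC.n lamC.m₃) (x : UT lamC.Nf), (Finset.univ.filter fun k => lamC.locN Z t k = x).card ≤ m) :
    locNFibreMax lamC ≤ m :=
  Finset.sup_le fun zt _ => fibreMax_le_of_forall_card_le _ (h zt.1 zt.2)

/-- ★ `locNFibreMax lamC ≤ m` IS the fibre bound (both directions). [cite: Balaban1985BackgroundPropagators, Thm 3.10 (3.107) p.416] -/
theorem locNFibreMax_le_iff {m : ℕ} :
    locNFibreMax lamC ≤ m ↔
      ∀ (Z : TDom 4 (lamC.n + 1)) (t : B13TermIdx θ lamC.n lamC.m₃) (x : UT lamC.Nf), (Finset.univ.filter fun k => lamC.locN Z t k = x).card ≤ m :=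
  ⟨fun hm Z t x => (card_locN_fibre_le lamC Z t x).trans hm, locNFibreMax_le_of_forall lamC⟩

/-- ★ THE JUNCTIONS' `hfibN` TEXT (62 ∕ 64 at `lamC.toK`) GIVES THE LOCATED INEQUALITY (converse of `hfibN_of_locNFibreMax_le`).
[cite: Balaban1985BackgroundPropagators, Thm 3.10 (3.107) p.416] -/
theorem locNFibreMax_le_of_hfibN {m : ℕ}
    (hfibN : ∀ Z t (x : UT lamC.toK.Nf), (Finset.univ.filter fun j => (lamC.toK.𝒦 Z t).locN j = x).card ≤ m) :
    locNFibreMax lamC ≤ m :=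
  locNFibreMax_le_of_forall lamC hfibN

end IntroCond

section IntroDec

variable {θ : Stage3Params} (lamD : ResidB13D θ)

/-- **INTRODUCTION RULE for `locFFibreMax`**. [cite: Balaban1985BackgroundPropagators, Thm 3.10 (3.107)–(3.108) p.416] -/
theorem locFFibreMax_le_of_forall {mF : ℕ}
    (h : ∀ (Z : TDom 4 (lamD.n + 1)) (t : B13TermIdx θ lamD.n lamD.m₃) (y : UT lamD.Nf), (Finset.univ.filter fun k => lamD.locF Z t k = y).card ≤ mF) :
    locFFibreMax lamD ≤ mF :=
  Finset.sup_le fun zt _ => fibreMax_le_of_forall_card_le _ (h zt.1 zt.2)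

/-- ★ `locFFibreMax lamD ≤ mF` IS module 67's `hfibF` (both directions; `hfibF`'s text elaborates to the right-hand side).
[cite: Balaban1985BackgroundPropagators, Thm 3.10 (3.107)–(3.108) p.416] -/
theorem locFFibreMax_le_iff {mF : ℕ} :
    locFFibreMax lamD ≤ mF ↔ ∀ Z t (y : UT lamD.toC.toK.Nf), (Finset.univ.filter fun k => lamD.locF Z t k = y).card ≤ mF :=
  ⟨hfibF_of_locFFibreMax_le lamD, locFFibreMax_le_of_forall lamD⟩

/-- ★ MODULE 67's `hfibN` TEXT (at `lamD.toC.toK`) GIVES `locNFibreMax lamD.toC ≤ m` (converse of `hfibN_decTower_of_le`).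
[cite: Balaban1985BackgroundPropagators, Thm 3.10 (3.107) p.416] -/
theorem locNFibreMax_decTower_le_of_hfibN {m : ℕ}
    (hfibN : ∀ Z t (x : UT lamD.toC.toK.Nf), (Finset.univ.filter fun j => (lamD.toC.toK.𝒦 Z t).locN j = x).card ≤ m) :
    locNFibreMax lamD.toC ≤ m :=
  locNFibreMax_le_of_hfibN lamD.toC hfibN

/-- **INTRODUCTION RULE for `cmAbsMax`**: a common bound `c ≥ 0` on the entries of `C` bounds the numeral. [cite: Balaban1988RG2Cluster, (2.5) p.12] -/
theorem cmAbsMax_le_of_forall {c : ℝ} (hc : 0 ≤ c) (h : ∀ Z t k i, |lamD.Cm Z t k i| ≤ c) : (cmAbsMax lamD : ℝ) ≤ c := by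
  classical
  have h1 : cmAbsMax lamD ≤ c.toNNReal := by
    unfold cmAbsMax
    exact Finset.sup_le fun zt _ => Finset.sup_le fun ki _ => Real.toNNReal_le_toNNReal (h zt.1 zt.2 ki.1 ki.2)
  have h2 : ((cmAbsMax lamD : NNReal) : ℝ) ≤ (c.toNNReal : ℝ) := NNReal.coe_le_coe.mpr h1
  rwa [Real.coe_toNNReal c hc] at h2

/-- ★ `cmAbsMax lamD ≤ 1` IS module 67's `hCle` (both directions). [cite: Balaban1988RG2Cluster, (2.5) p.12] -/
theorem cmAbsMax_le_one_iff : (cmAbsMax lamD : ℝ) ≤ 1 ↔ ∀ Z t k i, |lamD.Cm Z t k i| ≤ 1 :=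
  ⟨hCle_of_cmAbsMax_le_one lamD, cmAbsMax_le_of_forall lamD zero_le_one⟩

/-- **INTRODUCTION RULE for `cmRange`**: a common range `rC ≥ 0` of the non-zero entries of `C` bounds the numeral. [cite: Balaban1988RG2Cluster, (2.5) p.12, (2.14) p.15] -/
theorem cmRange_le_of_forall {rC : ℝ} (hrC : 0 ≤ rC)
    (h : ∀ Z t k i, lamD.Cm Z t k i ≠ 0 → tdist1 lamD.Nf (lamD.locF Z t k) (lamD.locN Z t i) ≤ rC) : (cmRange lamD : ℝ) ≤ rC := by
  classical
  have h1 : cmRange lamD ≤ rC.toNNReal := by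
    unfold cmRange
    refine Finset.sup_le fun zt _ => Finset.sup_le fun ki _ => ?_
    split_ifs with hne
    · exact Real.toNNReal_le_toNNReal (h zt.1 zt.2 ki.1 ki.2 hne)
    · exact zero_le
  have h2 : ((cmRange lamD : NNReal) : ℝ) ≤ (rC.toNNReal : ℝ) := NNReal.coe_le_coe.mpr h1
  rwa [Real.coe_toNNReal rC hrC] at h2

/-- ★ `cmRange lamD ≤ rC` IS module 67's `hCsupp` for `rC ≥ 0` (both directions; `hCsupp`'s text at `lamD.toC.toK` elaborates to the right-hand side).
[cite: Balaban1988RG2Cluster, (2.5) p.12, (2.14) p.15] -/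
theorem cmRange_le_iff {rC : ℝ} (hrC : 0 ≤ rC) :
    (cmRange lamD : ℝ) ≤ rC ↔ ∀ Z t k i, lamD.Cm Z t k i ≠ 0 → tdist1 lamD.toC.toK.Nf (lamD.locF Z t k) ((lamD.toC.toK.𝒦 Z t).locN i) ≤ rC :=
  ⟨hCsupp_of_cmRange_le lamD, cmRange_le_of_forall lamD hrC⟩

end IntroDec

end Literature.MathematicalPhysics.QuantumFieldTheory.Balaban1983to89.B13CondTowerLocationNumerals

end
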